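import Literature.Probability.RandomPlanarGeometry.LoewnerTransformContinuity
import Literature.Probability.RandomPlanarGeometry.LoewnerHullConnected
import HarnessLib

/-!
# `stub_detShadow` — shadowing the image of a perturbed Loewner hull by the reference trace
(crux `PathUpgradeR`, stmt-CriticalPhenomena-18055, line `bidir_windows`)

A DETERMINISTIC perturbation lemma about chordal Loewner chains in `ℍ`, seen in a Dobrushin
domain `E` through the boundary extension `ψ̄` of a uniformizing map `ψ : ℍ → E`.

**Theorem (`stub_detShadow`).** Let the chain of the continuous driver `V` have closed hulls
`closure K_t(V) = γ[0, t]` (`t > 0`), let `r := ψ̄ ∘ γ` have modulus `< ε/4` at scale `c` on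
`[0, T + 2]`, and suppose that at every RATIONAL time `q ∈ (0, T + 2]` the map
`W ↦ ψ̄ (closure K_q(W))` is continuous at `V` for the sup-norm on `[0, q]` and the Hausdorff
distance. Then there is one `δ₀ > 0` such that for every continuous `U` that is `δ₀`-close to `V`
on `[0, T + 2]` and every real `t ∈ (0, T + 1]`,
`hausdorffDist (ψ̄ (closure K_t(U))) (r[0, t]) ≤ ε`.

**Proof.** Pick a mesh `1/n < c` and the rational mesh points `q_k = k/n ≤ T + 2`; `δ₀` is the
minimum of the finitely many continuity radii at the `q_k` for accuracy `ε/4`. For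
`t ∈ (q_j, q_{j+1}]` sandwich `K_{q_j}(U) ⊆ K_t(U) ⊆ K_{q_{j+1}}(U)` (hulls increase) and compare
with `r[0, q_j] ⊆ r[0, t] ⊆ r[0, q_{j+1}]`, paying one modulus step `ε/4` for the overhang of
length `≤ 1/n < c`; the degenerate first window `j = 0` is handled through any point of the
(nonempty) hull. Finiteness of the Hausdorff edistance comes from compactness of closed hulls
(Lawler's Lemma 4.13, `Loewner.isBounded_closedHull`) and continuity of `ψ̄` on `{0 ≤ im}`
(Carathéodory). References: G. F. Lawler, *Conformally Invariant Processes in the Plane* (2005),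
§4.1, Lemma 4.13; Ch. Pommerenke, *Boundary Behaviour of Conformal Maps* (1992), Thm. 2.1.
[folklore]
-/

noncomputable section

open Set Filter Metric Topology Bornology
open scoped NNReal
open UpperHalfPlane (upperHalfPlaneSet)

namespace Summit.CriticalPhenomena.SAWScalingLimit.Theorems

open Literature.Probability.RandomPlanarGeometry Literature.Probability.RandomPlanarGeometry.Loewner

namespace PathUpgradeRDetShadow

variable {E : DobrushinDomain}

/-- The `ψ̄`-image of a closed hull at a positive time is nonempty
(`Loewner.hull_nonempty`). [folklore] -/
theorem image_closure_hull_nonempty (ψ : ConformalEquiv upperHalfPlaneSet E.carrier)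
    {W : ℝ≥0 → ℝ} (hW : Continuous W) {t : ℝ≥0} (ht : 0 < t) :
    (ψ.boundaryExtension '' closure (hull W t)).Nonempty :=
  ((hull_nonempty hW ht).mono subset_closure).image _

/-- The `ψ̄`-image of a closed hull is bounded: closed hulls are compact subsets of the closed
half-plane (Lawler's Lemma 4.13), on which `ψ̄` is continuous (Carathéodory). [folklore] -/
theorem isBounded_image_closure_hull (ψ : ConformalEquiv upperHalfPlaneSet E.carrier)
    {W : ℝ≥0 → ℝ} (hW : Continuous W) (t : ℝ≥0) :
    IsBounded (ψ.boundaryExtension '' closure (hull W t)) := by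
  have hcpt : IsCompact (closure (hull W t)) :=
    ((isBounded_closedHull hW t).subset (hull_subset_closedHull W t)).isCompact_closure
  have hsub : closure (hull W t) ⊆ {z : ℂ | 0 ≤ z.im} := by
    rw [← ConformalEquiv.closure_upperHalfPlaneSet_eq]
    exact closure_mono (hull_subset W t)
  exact (hcpt.image_of_continuousOn
    ((continuousOn_boundaryExtension_im_nonneg ψ).mono hsub)).isBounded

/-- The Hausdorff edistance between the `ψ̄`-images of two closed hulls at a positive time is
finite. [folklore] -/
theorem hausdorffEDist_image_ne_top (ψ : ConformalEquiv upperHalfPlaneSet E.carrier)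
    {U V : ℝ≥0 → ℝ} (hU : Continuous U) (hV : Continuous V) {t : ℝ≥0} (ht : 0 < t) :
    hausdorffEDist (ψ.boundaryExtension '' closure (hull U t))
      (ψ.boundaryExtension '' closure (hull V t)) ≠ ⊤ :=
  hausdorffEDist_ne_top_of_nonempty_of_bounded (image_closure_hull_nonempty ψ hU ht)
    (image_closure_hull_nonempty ψ hV ht) (isBounded_image_closure_hull ψ hU t)
    (isBounded_image_closure_hull ψ hV t)

/-- **Honest near points at one mesh level.** If `hausdorffDist (ψ̄ cl K_q(U)) (ψ̄ cl K_q(V)) ≤ a`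
with `a < b`, `q > 0`, and `closure K_q(V) = γ[0, q]`, then every point of `ψ̄ cl K_q(U)` is
`b`-close to some `ψ̄ (γ s)`, `s ≤ q`, and every `ψ̄ (γ s)`, `s ≤ q`, is `b`-close to
`ψ̄ cl K_q(U)`. [folklore] -/
theorem near (ψ : ConformalEquiv upperHalfPlaneSet E.carrier) {U V : ℝ≥0 → ℝ} {γ : ℝ≥0 → ℂ}
    (hU : Continuous U) (hV : Continuous V) {q : ℝ≥0} (hq : 0 < q)
    (hclos : closure (hull V q) = γ '' Icc 0 q) {a b : ℝ} (hab : a < b)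
    (hd : hausdorffDist (ψ.boundaryExtension '' closure (hull U q))
      (ψ.boundaryExtension '' closure (hull V q)) ≤ a) :
    (∀ x ∈ ψ.boundaryExtension '' closure (hull U q),
        ∃ s, s ≤ q ∧ dist x (ψ.boundaryExtension (γ s)) < b) ∧
      ∀ s, s ≤ q → ∃ x ∈ ψ.boundaryExtension '' closure (hull U q),
        dist (ψ.boundaryExtension (γ s)) x < b := by
  have fin := hausdorffEDist_image_ne_top ψ hU hV hq
  have hlt := hd.trans_lt hab
  refine ⟨fun x hx ↦ ?_, fun s hs ↦ ?_⟩
  · obtain ⟨y, hy, hxy⟩ := exists_dist_lt_of_hausdorffDist_lt hx hlt fin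
    rw [hclos, Set.image_image] at hy
    obtain ⟨s, hs, rfl⟩ := hy
    exact ⟨s, hs.2, hxy⟩
  · have hy : ψ.boundaryExtension (γ s) ∈ ψ.boundaryExtension '' closure (hull V q) := by
      rw [hclos, Set.image_image]
      exact ⟨s, ⟨zero_le, hs⟩, rfl⟩
    obtain ⟨x, hx, hxy⟩ := exists_dist_lt_of_hausdorffDist_lt' hy hlt fin
    exact ⟨x, hx, by rwa [dist_comm]⟩

/-- A positive lower bound for finitely many positive reals. [folklore] -/
theorem exists_pos_le_forall {ρ : ℕ → ℝ} (hρ : ∀ k, 0 < ρ k) (K : ℕ) :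
    ∃ δ, 0 < δ ∧ ∀ k, k ≤ K → δ ≤ ρ k := by
  induction K with
  | zero => exact ⟨ρ 0, hρ 0, fun k hk ↦ by rw [Nat.le_zero.1 hk]⟩
  | succ K ih =>
    obtain ⟨δ, hδ, h⟩ := ih
    refine ⟨min δ (ρ (K + 1)), lt_min hδ (hρ _), fun k hk ↦ ?_⟩
    rcases Nat.le_succ_iff.1 hk with hk | rfl
    · exact (min_le_left _ _).trans (h k hk)
    · exact min_le_right _ _

end PathUpgradeRDetShadow

open PathUpgradeRDetShadow in
/-- **Shadowing lemma (`stub_detShadow`).** With `closure K_t(V) = γ[0, t]`, a modulus `< ε/4`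
of `ψ̄ ∘ γ` at scale `c` on `[0, T + 2]`, and sup-norm continuity of `W ↦ ψ̄ (closure K_q(W))`
at `V` for every rational `q ∈ (0, T + 2]`, there is `δ₀ > 0` such that every continuous `U`
that is `δ₀`-close to `V` on `[0, T + 2]` has `hausdorffDist (ψ̄ cl K_t(U)) (ψ̄ γ[0, t]) ≤ ε` for
EVERY real `t ∈ (0, T + 1]` (rational mesh of size `< c`, monotonicity of hulls, one modulus
step for the overhang). [folklore] -/
theorem stub_detShadow : ∀ (E : Literature.Probability.RandomPlanarGeometry.DobrushinDomain) (ψ : Literature.Probability.RandomPlanarGeometry.ConformalEquiv UpperHalfPlane.upperHalfPlaneSet E.carrier), E.IsChordalUniformizing ψ → ∀ (V : NNReal → ℝ) (γ : NNReal → ℂ), Continuous V → Literature.Probability.RandomPlanarGeometry.Loewner.IsGeneratedByCurve V γ → Literature.Probability.RandomPlanarGeometry.Loewner.IsSimpleTrace γ → (∀ t : NNReal, 0 < t → closure (Literature.Probability.RandomPlanarGeometry.Loewner.hull V t) = γ '' Set.Icc 0 t) → ∀ (T : NNReal) (ε c : ℝ), 0 < ε → 0 < c → (∀ s t : NNReal,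 (s : ℝ) ≤ T + 2 → (t : ℝ) ≤ T + 2 → |(s : ℝ) - t| ≤ c → dist (ψ.boundaryExtension (γ s)) (ψ.boundaryExtension (γ t)) < ε / 4) → (∀ q : NNReal, 0 < q → (q : ℝ) ≤ T + 2 → (∃ z : ℚ, (q : ℝ) = z) → ∀ ε' : ℝ, 0 < ε' → ∃ ρ : ℝ, 0 < ρ ∧ ∀ W' : NNReal → ℝ, Continuous W' → (∀ s : NNReal, s ≤ q → |W' s - V s| ≤ ρ) → Metric.hausdorffDist (ψ.boundaryExtension '' closure (Literature.Probability.RandomPlanarGeometry.Loewner.hull W' q)) (ψ.boundaryExtension '' closure (Literature.Probability.RandomPlanarGeometry.Loewner.hull V q)) ≤ ε') → ∃ δ₀ : ℝ, 0 < δ₀ ∧ ∀ U : NNReal → ℝ, Continuous U → (∀ s : NNReal, (s : ℝ) ≤ T + 2 → |U s - V s| ≤ δ₀) → ∀ t : NNReal, 0 < t → (t : ℝ) ≤ T + 1 → Metric.hausdorffDist (ψ.boundaryExtension '' closure (Literature.Probability.RandomPlanarGeometry.Loewner.hull U t)) ((fun u => ψ.boundaryExtension (γ u)) '' Set.Icc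 0 t) ≤ ε := by
  intro E ψ _hψ V γ hV _hγ _hsimple hclos T ε c hε hc hmod hcont
  -- mesh size `1/n < c`
  obtain ⟨n, hn⟩ := exists_nat_gt (1 / c)
  have hn0 : (0 : ℝ) < n := (one_div_pos.2 hc).trans hn
  have hnc : 1 / (n : ℝ) < c := (one_div_lt hn0 hc).2 hn
  have h1n : (1 : ℝ) ≤ n := by
    have : n ≠ 0 := by rintro rfl; simp at hn0
    exact_mod_cast Nat.one_le_iff_ne_zero.2 this
  -- the rational mesh points `q k = k / n`
  set q : ℕ → ℝ≥0 := fun k ↦ (k : ℝ≥0) / n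
  have hq : ∀ k : ℕ, ((q k : ℝ≥0) : ℝ) = k / n := fun k ↦ by simp [q]
  -- continuity radii at the mesh points in `(0, T + 2]` (junk radius `1` elsewhere)
  have key : ∀ k : ℕ, ∃ ρ : ℝ, 0 < ρ ∧ (0 < k → (k : ℝ) / n ≤ T + 2 → ∀ W' : ℝ≥0 → ℝ,
      Continuous W' → (∀ s : ℝ≥0, s ≤ q k → |W' s - V s| ≤ ρ) →
        hausdorffDist (ψ.boundaryExtension '' closure (hull W' (q k)))
          (ψ.boundaryExtension '' closure (hull V (q k))) ≤ ε / 4) := by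
    intro k
    by_cases hk : 0 < k ∧ (k : ℝ) / n ≤ T + 2
    · have hqpos : (0 : ℝ) < q k := by rw [hq]; exact div_pos (Nat.cast_pos.2 hk.1) hn0
      obtain ⟨ρ, hρ, H⟩ := hcont (q k) (NNReal.coe_pos.1 hqpos) (by rw [hq]; exact hk.2)
        ⟨(k : ℚ) / n, by rw [hq]; push_cast; rfl⟩ (ε / 4) (by positivity)
      exact ⟨ρ, hρ, fun _ _ ↦ H⟩
    · exact ⟨1, one_pos, fun h1 h2 ↦ absurd ⟨h1, h2⟩ hk⟩
  choose ρ hρ hρH using key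
  obtain ⟨δ₀, hδ₀, hδρ⟩ := exists_pos_le_forall hρ ⌊((T : ℝ) + 2) * n⌋₊
  refine ⟨δ₀, hδ₀, fun U hU hUV t ht htT ↦ ?_⟩
  -- the level-`k` estimate for `U`
  have hlev : ∀ k : ℕ, 0 < k → (k : ℝ) ≤ ((T : ℝ) + 2) * n →
      hausdorffDist (ψ.boundaryExtension '' closure (hull U (q k)))
        (ψ.boundaryExtension '' closure (hull V (q k))) ≤ ε / 4 := by
    intro k hk hkT
    have hkT' : (k : ℝ) / n ≤ T + 2 := by rwa [div_le_iff₀ hn0]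
    refine hρH k hk hkT' U hU fun s hs ↦ (hUV s ?_).trans (hδρ k (Nat.le_floor hkT))
    calc (s : ℝ) ≤ q k := NNReal.coe_le_coe.2 hs
      _ = k / n := hq k
      _ ≤ T + 2 := hkT'
  -- locate `t` in the mesh: `q j ≤ t < q (j + 1)`
  set j : ℕ := ⌊(t : ℝ) * n⌋₊
  have ht0 : (0 : ℝ) < t := ht
  have htn : (0 : ℝ) ≤ t * n := by positivity
  have hj1 : (j : ℝ) ≤ t * n := Nat.floor_le htn
  have hj2 : (t : ℝ) * n < j + 1 := Nat.lt_floor_add_one _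
  have hqj : (q j : ℝ) ≤ t := by rw [hq, div_le_iff₀ hn0]; exact hj1
  have hqj1 : (t : ℝ) ≤ q (j + 1) := by rw [hq, le_div_iff₀ hn0]; push_cast; exact hj2.le
  have hgap : ((q (j + 1) : ℝ≥0) : ℝ) - q j = 1 / n := by rw [hq, hq]; push_cast; ring
  have hj1T : ((j + 1 : ℕ) : ℝ) ≤ ((T : ℝ) + 2) * n := by
    push_cast
    have : (t : ℝ) * n ≤ (T + 1) * n := mul_le_mul_of_nonneg_right htT hn0.le
    nlinarith
  have hqj1T : ((q (j + 1) : ℝ≥0) : ℝ) ≤ T + 2 := by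
    rw [hq, div_le_iff₀ hn0]; exact hj1T
  have htT2 : (t : ℝ) ≤ T + 2 := by linarith
  -- near points at the upper level `j + 1`
  obtain ⟨hupA, _⟩ := near ψ hU hV (q := q (j + 1)) (NNReal.coe_pos.1 (ht0.trans_le hqj1))
    (hclos _ (NNReal.coe_pos.1 (ht0.trans_le hqj1))) (by linarith : ε / 4 < ε / 2)
    (hlev (j + 1) (Nat.succ_pos j) hj1T)
  have hmonoU : ψ.boundaryExtension '' closure (hull U t) ⊆
      ψ.boundaryExtension '' closure (hull U (q (j + 1))) :=
    image_mono (closure_mono (hull_mono U (NNReal.coe_le_coe.1 hqj1)))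
  -- (up) every point of `ψ̄ cl K_t(U)` is `3ε/4`-close to `r[0, t]`
  have hup : ∀ x ∈ ψ.boundaryExtension '' closure (hull U t),
      ∃ s : ℝ≥0, s ≤ t ∧ dist x (ψ.boundaryExtension (γ s)) < 3 * ε / 4 := by
    intro x hx
    obtain ⟨s, hs, hxs⟩ := hupA x (hmonoU hx)
    by_cases hst : s ≤ t
    · exact ⟨s, hst, by linarith⟩
    · have hst' : (t : ℝ) < s := NNReal.coe_lt_coe.2 (not_le.1 hst)
      have hs' : (s : ℝ) ≤ q (j + 1) := NNReal.coe_le_coe.2 hs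
      have hm := hmod s t (hs'.trans hqj1T) htT2 (abs_sub_le_iff.2 ⟨by linarith, by linarith⟩)
      have htri := dist_triangle x (ψ.boundaryExtension (γ s)) (ψ.boundaryExtension (γ t))
      exact ⟨t, le_rfl, by linarith⟩
  refine hausdorffDist_le_of_mem_dist hε.le (fun x hx ↦ ?_) ?_
  · obtain ⟨s, hs, hxs⟩ := hup x hx
    exact ⟨_, ⟨s, ⟨zero_le, hs⟩, rfl⟩, by linarith⟩
  -- (down) every point of `r[0, t]` is `ε`-close to `ψ̄ cl K_t(U)`
  rintro _ ⟨s, ⟨-, hst⟩, rfl⟩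
  have hst' : (s : ℝ) ≤ t := NNReal.coe_le_coe.2 hst
  rcases Nat.eq_zero_or_pos j with hj0 | hjpos
  · -- first window: through any point of the nonempty hull
    obtain ⟨x, hx⟩ := image_closure_hull_nonempty ψ hU ht
    obtain ⟨s', hs'1, hxs'⟩ := hupA x (hmonoU hx)
    have h1 : ((q (j + 1) : ℝ≥0) : ℝ) = 1 / n := by rw [hq, hj0]; push_cast; ring
    have hs'r : (s' : ℝ) ≤ q (j + 1) := NNReal.coe_le_coe.2 hs'1
    have hs0 : (0 : ℝ) ≤ s := s.coe_nonneg
    have hs'0 : (0 : ℝ) ≤ s' := s'.coe_nonneg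
    have hm := hmod s s' (by linarith) (hs'r.trans hqj1T)
      (abs_sub_le_iff.2 ⟨by linarith, by linarith⟩)
    refine ⟨x, hx, ?_⟩
    rw [dist_comm] at hxs'
    have htri := dist_triangle (ψ.boundaryExtension (γ s)) (ψ.boundaryExtension (γ s')) x
    linarith
  · -- generic window: through the lower level `j`
    have hjT : (j : ℝ) ≤ ((T : ℝ) + 2) * n := le_trans (by push_cast; linarith) hj1T
    have hqjpos : 0 < q j :=
      NNReal.coe_pos.1 (by rw [hq]; exact div_pos (Nat.cast_pos.2 hjpos) hn0)
    obtain ⟨_, hloB⟩ := near ψ hU hV hqjpos (hclos _ hqjpos) (by linarith : ε / 4 < ε / 2)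
      (hlev j hjpos hjT)
    have hmonoL : ψ.boundaryExtension '' closure (hull U (q j)) ⊆
        ψ.boundaryExtension '' closure (hull U t) :=
      image_mono (closure_mono (hull_mono U (NNReal.coe_le_coe.1 hqj)))
    by_cases hsq : s ≤ q j
    · obtain ⟨x, hx, hsx⟩ := hloB s hsq
      exact ⟨x, hmonoL hx, by linarith⟩
    · have hsq' : ((q j : ℝ≥0) : ℝ) < s := NNReal.coe_lt_coe.2 (not_le.1 hsq)
      obtain ⟨x, hx, hsx⟩ := hloB (q j) le_rfl
      have hqjT : ((q j : ℝ≥0) : ℝ) ≤ T + 2 := by linarith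
      have hm := hmod s (q j) (by linarith) hqjT (abs_sub_le_iff.2 ⟨by linarith, by linarith⟩)
      have htri := dist_triangle (ψ.boundaryExtension (γ s)) (ψ.boundaryExtension (γ (q j))) x
      exact ⟨x, hmonoL hx, by linarith⟩

end Summit.CriticalPhenomena.SAWScalingLimit.Theorems
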